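import Literature.AlgebraicGeometry.Resolution.ValuedFunctionFields
import Mathlib.FieldTheory.SeparablyGenerated
import Mathlib.FieldTheory.IntermediateField.Adjoin.Algebra
import Mathlib.RingTheory.EssentialFiniteness
import Mathlib.Algebra.CharP.Algebra
import HarnessLib

/-!
# Stub `stub_separablyGeneratedOfLinearIndepOnPow` of crux stmt-ResolutionOfSingularities-0641
# (`Valuative.LuAlphaPTorsor`, line `pfaff-line-log-final-forms`, lead c6, reshape v6.7, S2)

**MacLane's criterion** (Stacks 030W, (2) ⇒ (1), finitely generated case; folklore): let `K`
be a field of characteristic `p > 0` and `F₀ ≤ K` a subfield over which `K` is finitely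
generated (`FGOver F₀ ⊤`). If every finite `F₀`-linearly independent subset of `K` stays
`F₀`-linearly independent after raising its elements to the `p`-th power, then `K/F₀` is
separably generated in the tree's ambient form `SeparablyGeneratedOver F₀ ⊤`: there is a finite
`t ⊆ K`, algebraically independent over `F₀`, with every element of `K` separable over `F₀(t)`.

This is Mathlib's `exists_isTranscendenceBasis_and_isSeparable_of_linearIndepOn_pow_of_essFiniteType`
with `k := ↥F₀`; the only work is the translation `FGOver F₀ ⊤ → Algebra.EssFiniteType ↥F₀ K`
(`IntermediateField.fg_top_iff`). Used to remove the hypothesis "`K/F₀` separably generated"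
from the dense-Abhyankar range of Knaf–Kuhlmann 2009, Thm. 1.5 (with Lemma 3.12 there).
-/

set_option linter.dupNamespace false

namespace Summit.ResolutionOfSingularities.ResolutionOfSingularities.Theorems.PfaffLine

open Literature.AlgebraicGeometry.Resolution

/-- If `K = F₀(s)` for a finite `s ⊆ K` (`FGOver F₀ ⊤`), then `K` is essentially of finite type
over the subfield `F₀`. [folklore] -/
theorem essFiniteType_of_fgOver_top {K : Type} [Field K] (F₀ : Subfield K)
    (hfg : FGOver F₀ (⊤ : Subfield K)) : Algebra.EssFiniteType F₀ K := by
  obtain ⟨s, hs⟩ := hfg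
  refine IntermediateField.fg_top_iff.mp ⟨s, ?_⟩
  apply IntermediateField.toSubfield_injective
  rw [IntermediateField.adjoin_toSubfield]
  have hr : Set.range (algebraMap F₀ K) = (F₀ : Set K) := Subtype.range_coe
  rw [hr, hs]
  rfl

/-- **MacLane's criterion** (Stacks 030W, (2) ⇒ (1), finitely generated case): a finitely
generated extension `K/F₀` in characteristic `p` in which `F₀`-linearly independent finite sets
stay independent after `p`-th powers is separably generated (`SeparablyGeneratedOver F₀ ⊤`).
[folklore] -/
theorem stub_separablyGeneratedOfLinearIndepOnPow :
    ∀ p : ℕ, p.Prime → ∀ (K : Type) [Field K] [CharP K p] (F₀ : Subfield K), Literature.AlgebraicGeometry.Resolution.FGOver F₀ ⊤ → (∀ s : Finset K, LinearIndepOn ↥F₀ _root_.id (s : Set K) → LinearIndepOn ↥F₀ (fun x : K => x ^ p) (s : Set K)) → Literature.AlgebraicGeometry.Resolution.SeparablyGeneratedOver F₀ ⊤ := by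
  intro p hp K _ _ F₀ hfg H
  haveI : Algebra.EssFiniteType F₀ K := essFiniteType_of_fgOver_top F₀ hfg
  haveI : ExpChar F₀ p := ExpChar.prime hp
  obtain ⟨s, hs, hsep⟩ :=
    exists_isTranscendenceBasis_and_isSeparable_of_linearIndepOn_pow_of_essFiniteType
      (k := F₀) (K := K) p hp H
  exact ⟨s, fun _ _ => Subfield.mem_top _, hs.1, fun x _ => Algebra.IsSeparable.isSeparable _ x⟩

end Summit.ResolutionOfSingularities.ResolutionOfSingularities.Theorems.PfaffLine
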